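import Mathlib
import Summits.Ventures.PercRepro2.SwOutMixedArmsClosureThm
import Summits.Ventures.PercRepro2.SwOutMixedArmsPlusSlabThm

/-!
# THE SEVERAL-ARMS BIG-BLOCK LEMMA UNDER THE CLOSURE AL⁺, WITH PIECES (blind cell PercRepro2,
night-4 g21, 2026-08-27; proofs/NIGHT4-G21.md §6)

**`mixedArmsPlus_card_le`**: for a junction with any number of u-arms (one at least), any number
of arms each with ANY number of pieces, and any number of far arms, every set `Q` of the raw cube
closed, between non-leaking points, under AL⁺ (`ArmLowerPlus`: `s`, `a`, `e`, `f` down, `uP`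
arbitrary, every u–p class that turns blue doing so with some u-arm red before and some u-arm blue
after — the closure of `MixedBaseR.mem_tgtU_of_lePlus`) satisfies, for every up-set `𝓔`,
`#{p ∈ Q : ¬ Leak p ∧ ER p ∈ 𝓔} ≤ #{p ∈ Q : ¬ Leak p ∧ EB p ∈ 𝓔}`.  Proof, per slice of the
far arms: the points with a red u-arm that are core points, together with the mixed points, are
handled by the cube principle on the core cube with the modified red set (`diag_stepA`); every
other point is unmixed and lies in exactly one slab cube, where the cube principle with the two
overlap points removed (`slab_step`) counts it; the slices are summed and the far arms flipped by
the cube principle fibre by fibre (`far_card_le`).  **`card_le_of_mixedArmsPlus_edges`** is the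
edge-set interface and **`MixedBaseR.rigid_block_plus`** the block theorem of a junction with
several mixed arms: the several-arms lift WITH pieces, closed through AL⁺.
-/

namespace Summit.Ventures.PercRepro2

namespace MixedArms

open scoped Classical

variable {ι ρ ν κ : Type*}

section SlicePlus

variable [Nonempty ι] [Fintype ι] [DecidableEq ι] [Fintype ρ] [DecidableEq ρ] [Fintype ν]
  [DecidableEq ν] [Fintype κ] [DecidableEq κ] {arm : ν → ρ} {Q : Set (PtR ι ρ ν κ)}

omit [Fintype ι] [DecidableEq ι] [Fintype ρ] [DecidableEq ρ] [Fintype ν] [DecidableEq ν]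
  [Fintype κ] [DecidableEq κ] in
/-- A non-leaking point that is not a core point with a red u-arm is unmixed. -/
lemma unmixed_of_not_coreRed {q : PtR ι ρ ν κ} (hq : ¬ Leak q arm)
    (hc : ¬ (Core q arm ∧ ∃ j, q.1 j = true)) : ∀ j, q.1 j = y0 q := by
  by_cases hr : ∃ j, q.1 j = true
  · by_cases hb : ∃ j, q.1 j = false
    · exfalso
      apply hc
      refine ⟨?_, hr⟩
      rcases (not_leak_iff arm q).1 hq with h | ⟨hs, -⟩ | ⟨hs, -⟩
      · exact h
      · obtain ⟨j, hj⟩ := hb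
        rw [hs] at hj
        exact absurd hj Bool.false_ne_true.symm
      · obtain ⟨j, hj⟩ := hr
        rw [hs] at hj
        exact absurd hj Bool.false_ne_true
    · intro j
      have h1 : q.1 j = true := by
        by_contra h
        exact hb ⟨j, by simpa using h⟩
      have h2 : y0 q = true := by
        by_contra h
        exact hb ⟨Classical.arbitrary ι, by simpa [y0] using h⟩
      rw [h1, h2]
  · intro j
    have h1 : q.1 j = false := by
      by_contra h
      exact hr ⟨j, by simpa using h⟩
    have h2 : y0 q = false := by
      by_contra h
      exact hr ⟨Classical.arbitrary ι, by simpa [y0] using h⟩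
    rw [h1, h2]

omit [Fintype ι] [DecidableEq ι] [Fintype ρ] [DecidableEq ρ] [Fintype ν] [DecidableEq ν]
  [Fintype κ] [DecidableEq κ] [Nonempty ι] in
/-- The bottom point of a slice lies below every point of the slice. -/
lemma botFA_le (q : PtR ι ρ ν κ) : (botFA q.2.2.2.2 : PtR ι ρ ν κ) ≤ q :=
  ⟨fun _ => Bool.false_le _, fun _ => Bool.false_le _, fun _ => Bool.false_le _,
    fun _ => Bool.false_le _, le_rfl⟩

omit [Fintype ι] [DecidableEq ι] [Fintype ρ] [DecidableEq ρ] [Fintype ν] [DecidableEq ν]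
  [Fintype κ] [Nonempty ι] in
/-- The `f`-frozen blue set contains the red set of the bottom point of its slice. -/
lemma ER_botFA_subset_EBT (q : PtR ι ρ ν κ) :
    ER (botFA q.2.2.2.2 : PtR ι ρ ν κ) ⊆ EBT ∅ q := by
  unfold EBT
  have h : (flipT ∅ q).2.2.2.2 = q.2.2.2.2 := by
    funext k
    simp only [flipT, Finset.notMem_empty, if_false]
  rw [← h]
  exact ER_mono (botFA_le _)

/-- **The slab part of a slice**: the points that are not core points with a red u-arm are counted
by the points that are not core points with a blue u-arm, slab cube by slab cube. -/
lemma slabs_step (hP : ArmLowerPlus arm Q) (f₀ : Config κ) {𝓔 : Set (Set (AtomR ι ρ ν κ))}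
    (h𝓔 : IsUpperSet 𝓔) (hF : ER (botFA f₀ : PtR ι ρ ν κ) ∉ 𝓔) :
    N (fun q : PtR ι ρ ν κ => (q ∈ Q ∧ ¬ Leak q arm ∧ q.2.2.2.2 = f₀ ∧ ER q ∈ 𝓔) ∧
        ¬ (Core q arm ∧ ∃ j, q.1 j = true)) ≤
      N (fun q : PtR ι ρ ν κ => (q ∈ Q ∧ ¬ Leak q arm ∧ q.2.2.2.2 = f₀ ∧ EBT ∅ q ∈ 𝓔) ∧
        ¬ (Core q arm ∧ ∃ j, q.1 j = false)) := by
  rw [N_eq_sum_fiber (idxA : PtR ι ρ ν κ → Finset ρ), N_eq_sum_fiber (idxA : PtR ι ρ ν κ → Finset ρ)]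
  apply Finset.sum_le_sum
  intro A _
  have key := slab_step (Q := Q) (arm := arm) (A := A) hP f₀ h𝓔 hF
  refine le_trans (le_of_eq (N_congr fun q => ?_)) (le_trans key (N_mono fun q hq => ?_))
  · constructor
    · rintro ⟨⟨⟨hQ, hL, hf, hE⟩, hc⟩, hA⟩
      exact ⟨⟨hQ, hL, hf, unmixed_of_not_coreRed hL hc, hA⟩, hc, hE⟩
    · rintro ⟨⟨hQ, hL, hf, -, hA⟩, hc, hE⟩
      exact ⟨⟨⟨hQ, hL, hf, hE⟩, hc⟩, hA⟩
  · obtain ⟨⟨hQ, hL, hf, -, hA⟩, hc, hE⟩ := hq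
    exact ⟨⟨⟨hQ, hL, hf, hE⟩, hc⟩, hA⟩

/-- **The slice inequality with pieces.** -/
theorem slice_card_le' (hP : ArmLowerPlus arm Q) {𝓔 : Set (Set (AtomR ι ρ ν κ))}
    (h𝓔 : IsUpperSet 𝓔) (f₀ : Config κ) :
    N (fun q : PtR ι ρ ν κ => q ∈ Q ∧ ¬ Leak q arm ∧ q.2.2.2.2 = f₀ ∧ ER q ∈ 𝓔) ≤
      N (fun q : PtR ι ρ ν κ => q ∈ Q ∧ ¬ Leak q arm ∧ q.2.2.2.2 = f₀ ∧ EBT ∅ q ∈ 𝓔) := by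
  by_cases hF : ER (botFA f₀ : PtR ι ρ ν κ) ∈ 𝓔
  · -- the trivial slice: every point of the slice counts on both sides
    calc N (fun q : PtR ι ρ ν κ => q ∈ Q ∧ ¬ Leak q arm ∧ q.2.2.2.2 = f₀ ∧ ER q ∈ 𝓔)
        ≤ N (fun q : PtR ι ρ ν κ => q ∈ Q ∧ ¬ Leak q arm ∧ q.2.2.2.2 = f₀) :=
          N_mono fun q h => ⟨h.1, h.2.1, h.2.2.1⟩
      _ ≤ N (fun q : PtR ι ρ ν κ => q ∈ Q ∧ ¬ Leak q arm ∧ q.2.2.2.2 = f₀ ∧ EBT ∅ q ∈ 𝓔) :=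
          N_mono fun q h => ⟨h.1, h.2.1, h.2.2, h𝓔 (by rw [← h.2.2]; exact ER_botFA_subset_EBT q) hF⟩
  · have h0 : (∅ : Set (AtomR ι ρ ν κ)) ∉ 𝓔 := fun h => hF (h𝓔 (Set.empty_subset _) h)
    rw [N_split_pred (fun q : PtR ι ρ ν κ => q ∈ Q ∧ ¬ Leak q arm ∧ q.2.2.2.2 = f₀ ∧ ER q ∈ 𝓔)
      (fun q => Core q arm ∧ ∃ j, q.1 j = true),
      N_split_pred (fun q : PtR ι ρ ν κ => q ∈ Q ∧ ¬ Leak q arm ∧ q.2.2.2.2 = f₀ ∧ EBT ∅ q ∈ 𝓔)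
      (fun q => Core q arm ∧ ∃ j, q.1 j = false)]
    refine Nat.add_le_add ?_ (slabs_step hP f₀ h𝓔 hF)
    have key := diag_stepA (Q := Q) (arm := arm) hP f₀ h𝓔 h0
    refine le_trans (le_of_eq (N_congr fun q => ?_)) (le_trans key (le_of_eq (N_congr fun q => ?_)))
    · exact ⟨fun ⟨h1, h2, h3⟩ => ⟨h1, h3, h2⟩, fun ⟨h1, h3, h2⟩ => ⟨h1, h2, h3⟩⟩
    · exact ⟨fun ⟨h1, h3, h2⟩ => ⟨h1, h2, h3⟩, fun ⟨h1, h2, h3⟩ => ⟨h1, h3, h2⟩⟩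

/-- **The inequality with the `f`-frozen blue set, with pieces**: the slices summed. -/
theorem frozen_card_le' (hP : ArmLowerPlus arm Q) {𝓔 : Set (Set (AtomR ι ρ ν κ))}
    (h𝓔 : IsUpperSet 𝓔) :
    N (fun q : PtR ι ρ ν κ => q ∈ Q ∧ ¬ Leak q arm ∧ ER q ∈ 𝓔) ≤
      N (fun q : PtR ι ρ ν κ => q ∈ Q ∧ ¬ Leak q arm ∧ EBT ∅ q ∈ 𝓔) := by
  rw [N_eq_sum_fiber (fun q : PtR ι ρ ν κ => q.2.2.2.2)
      (fun q : PtR ι ρ ν κ => q ∈ Q ∧ ¬ Leak q arm ∧ ER q ∈ 𝓔),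
    N_eq_sum_fiber (fun q : PtR ι ρ ν κ => q.2.2.2.2)
      (fun q : PtR ι ρ ν κ => q ∈ Q ∧ ¬ Leak q arm ∧ EBT ∅ q ∈ 𝓔)]
  apply Finset.sum_le_sum
  intro f₀ _
  have key := slice_card_le' hP h𝓔 f₀
  refine le_of_eq_of_le (N_congr fun q => ?_) (le_trans key (le_of_eq (N_congr fun q => ?_)))
  · exact ⟨fun ⟨⟨h1, h2, h3⟩, h4⟩ => ⟨h1, h2, h4, h3⟩, fun ⟨h1, h2, h4, h3⟩ => ⟨⟨h1, h2, h3⟩, h4⟩⟩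
  · exact ⟨fun ⟨h1, h2, h4, h3⟩ => ⟨⟨h1, h2, h3⟩, h4⟩, fun ⟨⟨h1, h2, h3⟩, h4⟩ => ⟨h1, h2, h4, h3⟩⟩

/-- **THE SEVERAL-ARMS BIG-BLOCK LEMMA UNDER AL⁺, WITH PIECES.** -/
theorem mixedArmsPlus_card_le (hP : ArmLowerPlus arm Q) {𝓔 : Set (Set (AtomR ι ρ ν κ))}
    (h𝓔 : IsUpperSet 𝓔) :
    (Finset.univ.filter fun p : PtR ι ρ ν κ => p ∈ Q ∧ ¬ Leak p arm ∧ ER p ∈ 𝓔).card ≤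
      (Finset.univ.filter fun p : PtR ι ρ ν κ => p ∈ Q ∧ ¬ Leak p arm ∧ EB p ∈ 𝓔).card := by
  have e1 : (Finset.univ.filter fun p : PtR ι ρ ν κ => p ∈ Q ∧ ¬ Leak p arm ∧ ER p ∈ 𝓔).card =
      N (fun p : PtR ι ρ ν κ => p ∈ Q ∧ ¬ Leak p arm ∧ ER p ∈ 𝓔) := by
    unfold N
    congr 1
    ext p
    simp only [Finset.mem_filter, Finset.mem_univ, true_and]
  have e2 : (Finset.univ.filter fun p : PtR ι ρ ν κ => p ∈ Q ∧ ¬ Leak p arm ∧ EB p ∈ 𝓔).card =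
      N (fun p : PtR ι ρ ν κ => p ∈ Q ∧ ¬ Leak p arm ∧ EB p ∈ 𝓔) := by
    unfold N
    congr 1
    ext p
    simp only [Finset.mem_filter, Finset.mem_univ, true_and]
  rw [e1, e2]
  exact le_trans (frozen_card_le' hP h𝓔) (far_card_le hP.armLower h𝓔)

end SlicePlus

section TransferPlus

open LocRows

variable {V : Type*} {E : Type*} [Fintype E]
variable [Nonempty ι] [Fintype ι] [DecidableEq ι] [Fintype ρ] [DecidableEq ρ] [Fintype ν]
  [DecidableEq ν] [Fintype κ] [DecidableEq κ] {arm : ν → ρ}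

/-- **The several-arms big-block principle under AL⁺, edge-set form** (pieces allowed): the twin
of `card_le_of_mixedArms_edges` with the closure AL⁺ as hypothesis. -/
theorem card_le_of_mixedArmsPlus_edges {ends : E → Sym2 V} (r : PtR ι ρ ν κ → Config E)
    (hr : ∀ p q, ¬ Leak p arm → ¬ Leak q arm → r p = r q → p = q) (C : Finset (Config E))
    (hC : ∀ ζ, ζ ∈ C ↔ ∃ p, ¬ Leak p arm ∧ r p = ζ) (Qs : Set (Config E))
    (hEv : ArmLowerPlus arm {p | r p ∈ Qs}) (h : V)
    (φ : Set (AtomR ι ρ ν κ) → Set E) (hφ : Monotone φ)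
    (hR : ∀ p, ¬ Leak p arm → redEdges ends (r p) h = φ (ER p))
    (hB : ∀ p, ¬ Leak p arm → blueEdges ends (r p) h = φ (EB p))
    {𝓔 : Set (Set E)} (h𝓔 : IsUpperSet 𝓔) :
    (C.filter fun ζ => ζ ∈ Qs ∧ redEdges ends ζ h ∈ 𝓔).card ≤
      (C.filter fun ζ => ζ ∈ Qs ∧ blueEdges ends ζ h ∈ 𝓔).card := by
  have e1 : (C.filter fun ζ => ζ ∈ Qs ∧ redEdges ends ζ h ∈ 𝓔) =
      (Finset.univ.filter fun p : PtR ι ρ ν κ =>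
        r p ∈ Qs ∧ ¬ Leak p arm ∧ ER p ∈ φ ⁻¹' 𝓔).image r := by
    ext ζ
    simp only [Finset.mem_filter, Finset.mem_image, Finset.mem_univ, true_and, Set.mem_preimage]
    constructor
    · rintro ⟨hζ, hQ, hE⟩
      obtain ⟨p, hp, rfl⟩ := (hC ζ).1 hζ
      refine ⟨p, ⟨hQ, hp, ?_⟩, rfl⟩
      rw [← hR p hp]
      exact hE
    · rintro ⟨p, ⟨hQ, hp, hE⟩, rfl⟩
      refine ⟨(hC _).2 ⟨p, hp, rfl⟩, hQ, ?_⟩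
      rw [hR p hp]
      exact hE
  have e2 : (C.filter fun ζ => ζ ∈ Qs ∧ blueEdges ends ζ h ∈ 𝓔) =
      (Finset.univ.filter fun p : PtR ι ρ ν κ =>
        r p ∈ Qs ∧ ¬ Leak p arm ∧ EB p ∈ φ ⁻¹' 𝓔).image r := by
    ext ζ
    simp only [Finset.mem_filter, Finset.mem_image, Finset.mem_univ, true_and, Set.mem_preimage]
    constructor
    · rintro ⟨hζ, hQ, hE⟩
      obtain ⟨p, hp, rfl⟩ := (hC ζ).1 hζ
      refine ⟨p, ⟨hQ, hp, ?_⟩, rfl⟩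
      rw [← hB p hp]
      exact hE
    · rintro ⟨p, ⟨hQ, hp, hE⟩, rfl⟩
      refine ⟨(hC _).2 ⟨p, hp, rfl⟩, hQ, ?_⟩
      rw [hB p hp]
      exact hE
  have inj1 : Set.InjOn r
      ↑(Finset.univ.filter fun p : PtR ι ρ ν κ => r p ∈ Qs ∧ ¬ Leak p arm ∧ ER p ∈ φ ⁻¹' 𝓔) := by
    intro p hp q hq hpq
    simp only [Finset.coe_filter, Finset.mem_univ, true_and, Set.mem_setOf_eq] at hp hq
    exact hr p q hp.2.1 hq.2.1 hpq
  have inj2 : Set.InjOn r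
      ↑(Finset.univ.filter fun p : PtR ι ρ ν κ => r p ∈ Qs ∧ ¬ Leak p arm ∧ EB p ∈ φ ⁻¹' 𝓔) := by
    intro p hp q hq hpq
    simp only [Finset.coe_filter, Finset.mem_univ, true_and, Set.mem_setOf_eq] at hp hq
    exact hr p q hp.2.1 hq.2.1 hpq
  rw [e1, e2, Finset.card_image_of_injOn inj1, Finset.card_image_of_injOn inj2]
  have h𝓔' : IsUpperSet (φ ⁻¹' 𝓔) := by
    intro S S' hSS' hS
    exact h𝓔 (hφ hSS') hS
  exact mixedArmsPlus_card_le (Q := {p | r p ∈ Qs}) hEv h𝓔'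

end TransferPlus

end MixedArms

end Summit.Ventures.PercRepro2
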